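import Summits.ResolutionOfSingularities.ResolutionOfSingularities.Theorems.MaxContactCutContactShadow

/-!
# MaxContactCutContactShadowAsides — the route asides of node «ContactShadow» unfolded and keyed BY NAME
(decomp-res writer g4; companion of `MaxContactCutContactShadow`, filed once the asides
`MaxContactCut.CSNoContactHuggingTowersPerfect`, `MaxContactCut.CSNoContactHuggingTowersImperfect`,
`MaxContactCut.CSNoWildShadowTowersImp`, `MaxContactCut.CSContactShadowAll`, `MaxContactCut.CSTowerObstructsAll`,
`MaxContactCut.CSFormalContactShadowAll`, `MaxContactCut.CSCornerNormalFormShAll`, `MaxContactCut.CSCornerModelGE`,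
`MaxContactCut.CSCurveLawShAll`, `MaxContactCut.CSSurfaceLawShAll`, `MaxContactCut.CSNoCornerTowerGEAll` exist on
the route).  Every statement here is an `Iff.rfl` unfolding or a by-name
re-keying of a kernel of `MaxContactCutContactShadow`; 0 sorry. [folklore]
-/

namespace Summit.ResolutionOfSingularities.ResolutionOfSingularities.Theorems.MaxContactCutContactShadowAsides

open CategoryTheory AlgebraicGeometry
open Literature.AlgebraicGeometry.Resolution
open Summit.ResolutionOfSingularities.ResolutionOfSingularities.Theses
open Summit.ResolutionOfSingularities.ResolutionOfSingularities.Theorems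
open WeakOrderReduction ForcedTowerClasses DivergentTowerClasses MonomialTowerClasses
open HugDimensionClasses HugDimensionKernels ContactShadowClasses ContactShadowKernels
open MaxContactCutContactShadow

/-! ## The asides unfolded -/

/-- `CSNoContactHuggingTowersPerfect` is the perfect column at every marking. [folklore] -/
theorem csPerfect_iff : MaxContactCut.CSNoContactHuggingTowersPerfect ↔ NoContactHuggingTowersPerfect := Iff.rfl

/-- `CSNoContactHuggingTowersImperfect` is the imperfect column at every marking. [folklore] -/
theorem csImperfect_iff : MaxContactCut.CSNoContactHuggingTowersImperfect ↔ NoContactHuggingTowersImperfect := Iff.rfl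

/-- `CSNoWildShadowTowersImp` is the located residual at every marking `n!`. [folklore] -/
theorem csWild_iff : MaxContactCut.CSNoWildShadowTowersImp ↔ NoWildShadowTowersImp := Iff.rfl

/-- `CSContactShadowAll` is the port `ContactShadow` at every marking. [folklore] -/
theorem csContactShadowAll_iff : MaxContactCut.CSContactShadowAll ↔ ∀ n : ℕ, 1 ≤ n → ContactShadow n := Iff.rfl

/-- `CSTowerObstructsAll` is the port `TowerObstructsAll`. [folklore] -/
theorem csTowerObstructsAll_iff : MaxContactCut.CSTowerObstructsAll ↔ TowerObstructsAll := Iff.rfl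

/-- `CSFormalContactShadowAll` is the port `FormalContactShadow` at every marking. [folklore] -/
theorem csFormalContactShadowAll_iff :
    MaxContactCut.CSFormalContactShadowAll ↔ ∀ n : ℕ, 1 ≤ n → FormalContactShadow n := Iff.rfl

/-- `CSCornerNormalFormShAll` is the port `CornerNormalFormSh` at every marking `≥ 1`. [folklore] -/
theorem csCornerNormalFormShAll_iff :
    MaxContactCut.CSCornerNormalFormShAll ↔ ∀ N : ℕ, 1 ≤ N → CornerNormalFormSh N := Iff.rfl

/-- `CSCornerModelGE` is the port `CornerModelGE`. [folklore] -/
theorem csCornerModelGE_iff : MaxContactCut.CSCornerModelGE ↔ CornerModelGE := Iff.rfl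

/-- `CSCurveLawShAll` is the port `CurveLawSh` at every marking `≥ 1`. [folklore] -/
theorem csCurveLawShAll_iff : MaxContactCut.CSCurveLawShAll ↔ ∀ N : ℕ, 1 ≤ N → CurveLawSh N := Iff.rfl

/-- `CSSurfaceLawShAll` is the port `SurfaceLawSh` at every marking `≥ 1`. [folklore] -/
theorem csSurfaceLawShAll_iff : MaxContactCut.CSSurfaceLawShAll ↔ ∀ N : ℕ, 1 ≤ N → SurfaceLawSh N := Iff.rfl

/-- `CSNoCornerTowerGEAll` is the `≥ N` combinatorial leaf in `d ≤ 3` parameters. [folklore] -/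
theorem csNoCornerTowerGEAll_iff :
    MaxContactCut.CSNoCornerTowerGEAll ↔ ∀ d N : ℕ, d ≤ 3 → 1 ≤ N → NoCornerTowerGE d N := Iff.rfl

/-! ## The node keyed to the asides -/

/-- **EXACT**: 31571 ⟺ its two column asides. [folklore] -/
theorem noContactHuggingTowers_iff_asides :
    MaxContactCut.NoContactHuggingTowers ↔
      MaxContactCut.CSNoContactHuggingTowersPerfect ∧ MaxContactCut.CSNoContactHuggingTowersImperfect :=
  noContactHuggingTowers_iff_columns

/-- The perfect column aside is implied by 31571 (WEAKER by letter, port-free). [folklore] -/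
theorem csPerfect_of_item (h : MaxContactCut.NoContactHuggingTowers) : MaxContactCut.CSNoContactHuggingTowersPerfect :=
  contactPerfect_of_item h

/-- The imperfect column aside is implied by 31571 (WEAKER by letter, port-free). [folklore] -/
theorem csImperfect_of_item (h : MaxContactCut.NoContactHuggingTowers) :
    MaxContactCut.CSNoContactHuggingTowersImperfect :=
  contactImperfect_of_item h

/-- **The perfect column aside is DECIDED modulo the port asides `CSContactShadowAll`, `CSTowerObstructsAll` and X1
28616 BY NAME.** [folklore] -/
theorem csPerfect_of_portAsides (hS : MaxContactCut.CSContactShadowAll) (hO : MaxContactCut.CSTowerObstructsAll)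
    (hX : MaxContactCut.MarkedThreefoldResolution) : MaxContactCut.CSNoContactHuggingTowersPerfect :=
  noContactHuggingTowersPerfect_of_ports hS hO hX

/-- The `≥ N` combinatorial leaf aside from the two bookkeeping port asides. [folklore] -/
theorem csNoCornerTowerGEAll_of_model (hM : MaxContactCut.CSCornerModelGE) (hT : MaxContactCut.CSTowerObstructsAll) :
    MaxContactCut.CSNoCornerTowerGEAll :=
  fun d N hd hN => noCornerTowerGE_of_model hM hT d N (by omega) hN

/-- **The imperfect column aside is LOCATED**: it follows from the port asides `CSFormalContactShadowAll`,
`CSCornerNormalFormShAll`, `CSNoCornerTowerGEAll`, `CSCurveLawShAll`, `CSSurfaceLawShAll` and THE RESIDUAL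
`CSNoWildShadowTowersImp`. [folklore] -/
theorem csImperfect_of_leafAsides (hF : MaxContactCut.CSFormalContactShadowAll)
    (hCN : MaxContactCut.CSCornerNormalFormShAll) (hC : MaxContactCut.CSNoCornerTowerGEAll)
    (hCL : MaxContactCut.CSCurveLawShAll) (hSL : MaxContactCut.CSSurfaceLawShAll)
    (hW : MaxContactCut.CSNoWildShadowTowersImp) : MaxContactCut.CSNoContactHuggingTowersImperfect := by
  intro n hn
  have hN : 1 ≤ n.factorial := Nat.succ_le_of_lt n.factorial_pos
  exact contactImperfect_of_formal (hF n hn)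
    (shadowImp_of_pieces (shadowTransversal_of_ports (hCN _ hN) fun d hd => hC d _ hd hN)
      (shadowCurve_of_law (hCL _ hN)) (shadowContact_of_law (hSL _ hN)) (hW n hn))

/-- The imperfect column aside from the port asides with `CSCornerModelGE` + `CSTowerObstructsAll` in place of the
combinatorial leaf. [folklore] -/
theorem csImperfect_of_portAsides (hF : MaxContactCut.CSFormalContactShadowAll)
    (hCN : MaxContactCut.CSCornerNormalFormShAll) (hCM : MaxContactCut.CSCornerModelGE)
    (hT : MaxContactCut.CSTowerObstructsAll) (hCL : MaxContactCut.CSCurveLawShAll)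
    (hSL : MaxContactCut.CSSurfaceLawShAll) (hW : MaxContactCut.CSNoWildShadowTowersImp) :
    MaxContactCut.CSNoContactHuggingTowersImperfect :=
  csImperfect_of_leafAsides hF hCN (csNoCornerTowerGEAll_of_model hCM hT) hCL hSL hW

/-- **31571 FROM THE ASIDES**: the port asides, X1 and the residual. [folklore] -/
theorem noContactHuggingTowers_of_asides (hS : MaxContactCut.CSContactShadowAll)
    (hO : MaxContactCut.CSTowerObstructsAll) (hX : MaxContactCut.MarkedThreefoldResolution)
    (hF : MaxContactCut.CSFormalContactShadowAll) (hCN : MaxContactCut.CSCornerNormalFormShAll)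
    (hCM : MaxContactCut.CSCornerModelGE) (hCL : MaxContactCut.CSCurveLawShAll)
    (hSL : MaxContactCut.CSSurfaceLawShAll) (hW : MaxContactCut.CSNoWildShadowTowersImp) :
    MaxContactCut.NoContactHuggingTowers :=
  noContactHuggingTowers_iff_asides.mpr
    ⟨csPerfect_of_portAsides hS hO hX, csImperfect_of_portAsides hF hCN hCM hO hCL hSL hW⟩

/-- **30253 `NoForcedTowers` FROM THE ASIDES** through the tree's leaves `CornerNormalFormAll` 31573 and
`NoWildHuggingTowers` 31572 BY NAME. [folklore] -/
theorem noForcedTowers_of_asides (hN : MaxContactCut.CornerNormalFormAll) (hS : MaxContactCut.CSContactShadowAll)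
    (hO : MaxContactCut.CSTowerObstructsAll) (hX : MaxContactCut.MarkedThreefoldResolution)
    (hF : MaxContactCut.CSFormalContactShadowAll) (hCN : MaxContactCut.CSCornerNormalFormShAll)
    (hCM : MaxContactCut.CSCornerModelGE) (hCL : MaxContactCut.CSCurveLawShAll)
    (hSL : MaxContactCut.CSSurfaceLawShAll) (hW : MaxContactCut.CSNoWildShadowTowersImp)
    (h₂ : MaxContactCut.NoWildHuggingTowers) : MaxContactCut.NoForcedTowers :=
  MaxContactCutMonomialTowers.noForcedTowers_of_leaves hN
    (noContactHuggingTowers_of_asides hS hO hX hF hCN hCM hCL hSL hW) h₂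

end Summit.ResolutionOfSingularities.ResolutionOfSingularities.Theorems.MaxContactCutContactShadowAsides
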